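import Literature.Algebra.Homology.HyperExtTermwiseVanishing
import Literature.AlgebraicGeometry.Crystalline.HuComplexesPresentation
import Literature.AlgebraicGeometry.Crystalline.DeRhamComplexHodgeSheaves
import Literature.AlgebraicGeometry.KTheory.HuInfinitesimalKZero
import Literature.AlgebraicGeometry.Modules.CokernelSupport
import Literature.AlgebraicGeometry.Motives.WittSchemeSpecialFibreLocus
import Literature.AlgebraicGeometry.Motives.VarietiesDimensionProofs
import Literature.Topology.SubsetKrullDimension
import Mathlib.AlgebraicGeometry.Noetherian
import Mathlib.RingTheory.WittVector.DiscreteValuationRing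
import HarnessLib

/-!
# Hypercohomology of X. Hu's complexes `p^{r,M}_{r,N}Ω•` above the dimension of the special fibre

Let `k` be a perfect field of characteristic `p`, `𝒳/W(k)` a smooth proper model of relative
dimension `d` (`Motives.WittScheme.IsSmoothProperModel d 𝒳`), and
`p^{r,M}_{r,N}Ω• = Crystalline.huComplex 𝒳 p r M N` X. Hu's complex (arXiv:2507.12458, Def. 8.2;
`Crystalline/HuComplexes`), with hypercohomology `ℍⁱ = KTheory.huH p k 𝒳 r M N i`
(`KTheory/HuInfinitesimalKZero`, on `|𝒳|`). This file proves the DIMENSION BOUNDS of that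
hypercohomology and their consequence for the reduction maps:

* `isSupportedOn_huComplex_X` — every term `p^{(r-j)M}(Ωʲ/p^{(r-j)N})` is an abelian sheaf on
  `|𝒳|` supported on the zero locus `V(p) = |𝒳| ∖ D(p)` of `p` (it is a subquotient of the
  `𝒪_𝒳`-module `Ωʲ_{𝒳/W}` killed by a power of `p`; `Modules/CokernelSupport` and the identification
  `(Ω•)ʲ ≅ Ωʲ` of `Crystalline/DeRhamComplexHodgeSheaves`), for every `W`-scheme and every integer
  in place of `p`; the same for the `ℤ`-extension `huComplexInt` (`isSupportedOn_huComplexInt_X`);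
* `noetherianSpace_left_of_isProper`, `sdim_specialFibreLocus_lt` — for `𝒳/W(k)`
  proper, `|𝒳|` is a noetherian space, and for a smooth proper model of relative dimension `d` the
  closed subset `V(p) = range (X_k → 𝒳)` (`Motives/WittSchemeSpecialFibreLocus`) has
  `sdim V(p) ≤ d` (`Topology/SubsetKrullDimension` + `dim X_k ≤ d`,
  `Motives/VarietiesDimensionProofs`);
* `ext_huComplexInt_X_eq_zero` — hence (Grothendieck vanishing WITH SUPPORTS,
  `Motives.GrothendieckVanishingProof.vanishingOn`) `Hⁱ(|𝒳|, term) = 0` for all `i > d`;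
* `huH_eq_zero_of_lt` — **`ℍⁱ(p^{r,M}_{r,N}Ω•) = 0` for `i > (r - 1) + d`**
  (`Algebra/Homology/HyperExtTermwiseVanishing.eq_zero_of_termwise`; the complex sits in degrees
  `[0, r-1]`); in particular `ℍ^{2r-1} = 0` for `r ≥ d + 1` and `ℍ^{2r} = 0` for `r ≥ d`;
* `huHReduce_surjective_of_le` — **the reductions `ℍⁱ(p^{r,m}_{r,n'}Ω•) → ℍⁱ(p^{r,m}_{r,n}Ω•)`
  (`KTheory.huHReduce`, `m ≤ n ≤ n'`) are surjective for `i ≥ (r - 1) + d`**: the kernel of the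
  reduction of complexes is `p^{r,n}_{r,n'}Ω•` (Hu's short exact three-term sequence
  `Crystalline.hu_shortExact_int` of `Crystalline/HuComplexesPresentation`), whose `ℍⁱ⁺¹`
  vanishes; at `i = 2r - 1` this is the case **`r ≥ d`** of the surjectivity of the transitions of
  Hu's kernel sources `⊕_r ℍ^{2r-1}` (`huHReduce_surjective_of_dim_le`), the high-weight corner of
  the lattice lemma (L1) of the `p`-adic lifting argument (Bloch–Esnault–Kerz, Invent. Math. 195
  (2014), §8; X. Hu, arXiv:2507.12458, proof of Prop. 11.1) — the weights `r ≤ d - 1` need the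
  degeneration of Hodge–de Rham instead and are not treated here; `huHReduce_odd_surjective_of_lowWeights`
  records that they are all that is left (all weights `r ≥ 1` from the weights `1 ≤ r < d`).

Everything is proved ([folklore] homological algebra and dimension theory on the cited objects; no
statement of the cited papers is asserted). References: R. Hartshorne, *Algebraic Geometry* (1977),
III.2.7 and III Ex. 2.3 (vanishing with supports), II Ex. 3.20 (dimension); X. Hu, arXiv:2507.12458,
Def. 8.2, §11.
-/

noncomputable section

open CategoryTheory CategoryTheory.Limits Opposite TopologicalSpace
open _root_.AlgebraicGeometry
open Literature.Algebra.Homology Literature.AlgebraicGeometry.Motives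
open Literature.AlgebraicGeometry.Modules

universe u

namespace Literature.AlgebraicGeometry.Crystalline

/-! ### The terms of Hu's complexes are supported on `V(q)` -/

section Support

variable {A : Type u} [CommRing A] (X : Over (Spec (CommRingCat.of A))) (q : ℤ)

/-- A sheaf supported on `Y` stays supported on `Y` along any monomorphism INTO it from a zero
object; phrased: a zero abelian sheaf is supported on every subset. [folklore] -/
theorem isSupportedOn_of_isZero {T : TopCat.{u}}
    {F : Sheaf (Opens.grothendieckTopology T) AddCommGrpCat.{u}} (hF : IsZero F)
    (G : Sheaf (Opens.grothendieckTopology T) AddCommGrpCat.{u}) (Y : Set T)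
    (hG : IsSupportedOn G Y) : IsSupportedOn F Y :=
  haveI : Mono (0 : F ⟶ G) := hF.mono _
  hG.of_mono (0 : F ⟶ G)

/-- **The staircase quotients `Ωʲ/q^{e}` are supported on `V(q)`**: the degree-`j` term
`cokernel (q^{e j} • 𝟙 (Ω•)ʲ)` of a staircase reduction of the algebraic de Rham complex of an
`A`-scheme `X` is supported on the zero locus `|X| ∖ D(q)` of the global function `q` — `(Ω•)ʲ` is
the abelian sheaf of the `𝒪_X`-module `Ωʲ_{X/A}` (`algebraicDeRhamComplexXIso`), on which `q` is
invertible over `D(q)` (`Modules.isSupportedOn_of_epi_of_zsmul_comp_eq_zero`). [folklore] -/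
theorem isSupportedOn_powQuotient_algebraicDeRhamComplex_X {e : ℕ → ℕ} (he : Antitone e) (j : ℕ) :
    IsSupportedOn ((powQuotient (algebraicDeRhamComplex X) q he).X j)
      ((X.left.basicOpen (q : Γ(X.left, ⊤)) : Set X.left))ᶜ := by
  let ε := algebraicDeRhamComplexXIso X j
  haveI : Epi (ε.inv ≫ cokernel.π (powSMul (algebraicDeRhamComplex X) q e j)) := epi_comp _ _
  refine isSupportedOn_of_epi_of_zsmul_comp_eq_zero (hodgeSheaf X j)
    (ε.inv ≫ cokernel.π (powSMul (algebraicDeRhamComplex X) q e j)) q (e j) ?_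
  calc ((q ^ e j : ℤ) • 𝟙 _) ≫ ε.inv ≫ cokernel.π (powSMul (algebraicDeRhamComplex X) q e j)
      = ε.inv ≫ (powSMul (algebraicDeRhamComplex X) q e j ≫
          cokernel.π (powSMul (algebraicDeRhamComplex X) q e j)) := by
        simp only [powSMul, Preadditive.zsmul_comp, Preadditive.comp_zsmul, Category.id_comp]
    _ = 0 := by rw [cokernel.condition, comp_zero]

/-- The terms `Ωʲ_{X_{(r-j)N}} = Ωʲ/q^{(r-j)N}` of the staircase reduction `deRhamReduction X q r N`
are supported on `V(q)`. [folklore] -/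
theorem isSupportedOn_deRhamReduction_X (r N j : ℕ) :
    IsSupportedOn ((deRhamReduction X q r N).X j)
      ((X.left.basicOpen (q : Γ(X.left, ⊤)) : Set X.left))ᶜ :=
  isSupportedOn_powQuotient_algebraicDeRhamComplex_X X q (antitone_staircase r N) j

/-- **The terms of X. Hu's complex `p^{r,M}_{r,N}Ω•` are supported on `V(q)`** (they are subsheaves,
`powImageι`, of the staircase quotients). [folklore] -/
theorem isSupportedOn_huComplex_X (r M N j : ℕ) :
    IsSupportedOn ((huComplex X q r M N).X j)
      ((X.left.basicOpen (q : Γ(X.left, ⊤)) : Set X.left))ᶜ :=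
  (isSupportedOn_deRhamReduction_X X q r N j).of_mono ((huComplexι X q r M N).f j)

/-- The terms of the `ℤ`-extension `huComplexInt X q r M N` are supported on `V(q)` (in non-negative
degrees they are the terms of `huComplex`, `HomologicalComplex.extendXIso`; elsewhere zero).
[folklore] -/
theorem isSupportedOn_huComplexInt_X (r M N : ℕ) (j : ℤ) :
    IsSupportedOn ((huComplexInt X q r M N).X j)
      ((X.left.basicOpen (q : Γ(X.left, ⊤)) : Set X.left))ᶜ := by
  by_cases hj : 0 ≤ j
  · obtain ⟨n, rfl⟩ := Int.eq_ofNat_of_zero_le hj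
    exact (isSupportedOn_huComplex_X X q r M N n).of_mono
      ((huComplex X q r M N).extendXIso ComplexShape.embeddingUpNat (i := n) (by simp)).hom
  · exact isSupportedOn_of_isZero
      ((huComplex X q r M N).isZero_extend_X ComplexShape.embeddingUpNat j fun i hi => hj
        (by simp at hi; omega))
      ((huComplex X q r M N).X 0) _ (isSupportedOn_huComplex_X X q r M N 0)

end Support

/-! ### `p`-adic models: noetherian total space, dimension of the special fibre -/

section WittModel

open WittScheme

variable {p : ℕ} [Fact p.Prime] {k : Type} [Field k] [CharP k p]
  (𝒳 : SchemeOver (WittVector p k))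

/-- The total space of a proper `W(k)`-scheme (`k` a perfect field, so `W(k)` is a discrete
valuation ring, in particular noetherian) is a noetherian scheme: locally noetherian (locally of
finite type over a noetherian base, Mathlib `LocallyOfFiniteType.isLocallyNoetherian`) and
quasi-compact (over the affine base). [folklore] -/
theorem isNoetherian_left_of_isProper [PerfectRing k p] [IsProper 𝒳.hom] : IsNoetherian 𝒳.left := by
  haveI : IsLocallyNoetherian 𝒳.left := LocallyOfFiniteType.isLocallyNoetherian 𝒳.hom
  haveI : CompactSpace 𝒳.left := QuasiCompact.compactSpace_of_compactSpace 𝒳.hom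
  exact ⟨⟩

/-- The total space of a proper `W(k)`-scheme is a noetherian topological space. [folklore] -/
theorem noetherianSpace_left_of_isProper [PerfectRing k p] [IsProper 𝒳.hom] : NoetherianSpace 𝒳.left :=
  haveI := isNoetherian_left_of_isProper 𝒳
  inferInstance

/-- A scheme smooth of relative dimension `d` over a field has Krull dimension `≤ d` (every local
ring has dimension `≤ d`, `Motives.ringKrullDim_stalk_le_of_smoothOfRelativeDimension`, and
`dim = sup` of these, `Motives.Scheme.topologicalKrullDim_eq_iSup_ringKrullDim_stalk`; no
non-emptiness needed for the inequality). [folklore] -/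
theorem topologicalKrullDim_le_of_smoothOfRelativeDimension {K : Type u} [Field K] {Y : Scheme.{u}}
    (f : Y ⟶ Spec (CommRingCat.of K)) (d : ℕ) [SmoothOfRelativeDimension d f] :
    topologicalKrullDim Y ≤ d := by
  rw [Scheme.topologicalKrullDim_eq_iSup_ringKrullDim_stalk]
  exact iSup_le fun x => ringKrullDim_stalk_le_of_smoothOfRelativeDimension f d x

variable {𝒳} in
/-- For a smooth proper model `𝒳/W(k)` of relative dimension `d`, the special fibre `X_k` has
Krull dimension `≤ d`. [folklore] -/
theorem topologicalKrullDim_specialFibre_le {d : ℕ} (h𝒳 : IsSmoothProperModel d 𝒳) :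
    topologicalKrullDim (specialFibre 𝒳).left ≤ d :=
  haveI := h𝒳.isSmoothProjective_specialFibre.smoothOfRelativeDimension
  topologicalKrullDim_le_of_smoothOfRelativeDimension (specialFibre 𝒳).hom d

variable {𝒳} in
/-- **`sdim V(p) ≤ d`**: for a smooth proper model `𝒳/W(k)` of relative dimension `d`, the zero
locus `V(p) = |𝒳| ∖ D(p)` — the image of the closed embedding `X_k → 𝒳`
(`WittScheme.range_specialFibreι_eq_compl_basicOpen`) — has subset dimension `< i` for every
`i > d` (`Topology.sdim_range_lt_of_topologicalKrullDim_le`): the hypothesis shape of Grothendieck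
vanishing with supports. [folklore] -/
theorem sdim_specialFibreLocus_lt {d : ℕ} (h𝒳 : IsSmoothProperModel d 𝒳) {i : ℕ}
    (hi : d < i) :
    sdim ((𝒳.left.basicOpen (p : Γ(𝒳.left, ⊤)) : Set 𝒳.left))ᶜ < i := by
  rw [← range_specialFibreι_eq_compl_basicOpen]
  exact Literature.Topology.sdim_range_lt_of_topologicalKrullDim_le
    (isClosedEmbedding_specialFibreι 𝒳) (topologicalKrullDim_specialFibre_le h𝒳) hi

variable {𝒳} in
/-- **Vanishing with supports on the special fibre**: for a smooth proper model `𝒳/W(k)` of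
relative dimension `d`, an abelian sheaf `G` on `|𝒳|` supported on `V(p)` has `Hⁱ(|𝒳|, G) = 0`
for all `i > d` (Grothendieck vanishing with supports, `GrothendieckVanishingProof.vanishingOn`,
Hartshorne III.2.7 / III Ex. 2.3). [folklore] -/
theorem ext_eq_zero_of_isSupportedOn_specialFibreLocus [PerfectRing k p] {d : ℕ} (h𝒳 : IsSmoothProperModel d 𝒳)
    (G : Sheaf (Opens.grothendieckTopology 𝒳.left) AddCommGrpCat.{0})
    (hG : IsSupportedOn G ((𝒳.left.basicOpen (p : Γ(𝒳.left, ⊤)) : Set 𝒳.left))ᶜ)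
    {i : ℕ} (hi : d < i)
    (y : Abelian.Ext.{0} (constantSheafInt (Opens.grothendieckTopology 𝒳.left)) G i) : y = 0 := by
  haveI := h𝒳.isProper
  haveI := noetherianSpace_left_of_isProper 𝒳
  haveI : Subsingleton (G.H i) :=
    GrothendieckVanishingProof.vanishingOn (𝒳.left.basicOpen (p : Γ(𝒳.left, ⊤))).compl G hG i
      (sdim_specialFibreLocus_lt h𝒳 hi)
  exact Subsingleton.elim (α := G.H i) _ _

/-! ### Hypercohomology of Hu's complexes above `(r - 1) + d` -/

variable {𝒳} in
/-- The terms of `huComplexInt 𝒳 p r M N` have no cohomology above `d` on `|𝒳|`, for a smooth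
proper model `𝒳/W(k)` of relative dimension `d`. [folklore] -/
theorem ext_huComplexInt_X_eq_zero [PerfectRing k p] {d : ℕ} (h𝒳 : IsSmoothProperModel d 𝒳) (r M N : ℕ) (j : ℤ)
    (i : ℕ) (hi : d < i)
    (y : Abelian.Ext.{0} (constantSheafInt (Opens.grothendieckTopology 𝒳.left))
      ((huComplexInt 𝒳 (p : ℤ) r M N).X j) i) : y = 0 :=
  ext_eq_zero_of_isSupportedOn_specialFibreLocus h𝒳 _
    (by simpa only [Int.cast_natCast] using isSupportedOn_huComplexInt_X 𝒳 (p : ℤ) r M N j) hi y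

variable {𝒳} in
/-- **`ℍⁱ(p^{r,M}_{r,N}Ω•) = 0` for `i > (r - 1) + d`** on a smooth proper model `𝒳/W(k)` of
relative dimension `d`: the complex sits in degrees `[0, r - 1]` and its terms, supported on the
`d`-dimensional special fibre, have no cohomology above `d`
(`HyperExt.eq_zero_of_termwise`). In particular `ℍ^{2r-1} = 0` for `r ≥ d + 1` and `ℍ^{2r} = 0`
for `r ≥ d`. [folklore] -/
theorem huH_eq_zero_of_lt [PerfectRing k p] {d : ℕ} (h𝒳 : IsSmoothProperModel d 𝒳) (r M N : ℕ) {i : ℤ}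
    (hi : (r : ℤ) - 1 + d < i) (x : KTheory.huH p k 𝒳 r M N i) : x = 0 :=
  HyperExt.eq_zero_of_termwise (hA := HyperExt.hasHyperExt_singleFunctor_obj _)
    (constantSheafInt (Opens.grothendieckTopology 𝒳.left))
    (huComplexInt 𝒳 (p : ℤ) r M N) ((r : ℤ) - 1) d
    (fun j i hi' y => ext_huComplexInt_X_eq_zero h𝒳 r M N j i hi' y) hi x

/-! ### Surjectivity of the reductions above `(r - 1) + d` -/

variable {𝒳} in
/-- **The reductions `ℍⁱ(p^{r,m}_{r,n'}Ω•) → ℍⁱ(p^{r,m}_{r,n}Ω•)` are surjective for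
`i ≥ (r - 1) + d`** (`m ≤ n ≤ n'`, smooth proper model `𝒳/W(k)` of relative dimension `d`): by
Hu's short exact sequence `0 → p^{r,n}_{r,n'}Ω• → p^{r,m}_{r,n'}Ω• → p^{r,m}_{r,n}Ω• → 0` the
cokernel of the reduction on `ℍⁱ` embeds into `ℍⁱ⁺¹(p^{r,n}_{r,n'}Ω•) = 0` (`huH_eq_zero_of_lt`,
`HyperExt.map_surjective_of_termwise` on `Crystalline.hu_shortExact_int`). [folklore] -/
theorem huHReduce_surjective_of_le [PerfectRing k p] {d : ℕ} (h𝒳 : IsSmoothProperModel d 𝒳) (r m : ℕ) {n n' : ℕ}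
    (hmn : m ≤ n) (h : n ≤ n') {i : ℤ} (hi : (r : ℤ) - 1 + d ≤ i) :
    Function.Surjective (KTheory.huHReduce p k 𝒳 r m h i) :=
  haveI : CochainComplex.IsStrictlyLE (huShortComplexInt 𝒳 (p : ℤ) r hmn h).X₁ ((r : ℤ) - 1) :=
    isStrictlyLE_huComplexInt 𝒳 (p : ℤ) r n n'
  HyperExt.map_surjective_of_termwise (hA := HyperExt.hasHyperExt_singleFunctor_obj _)
    (constantSheafInt (Opens.grothendieckTopology 𝒳.left))
    (hu_shortExact_int 𝒳 (p : ℤ) r hmn h) ((r : ℤ) - 1) d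
    (fun j i hi' y => ext_huComplexInt_X_eq_zero h𝒳 r n n' j i hi' y) hi

variable {𝒳} in
/-- **The high-weight corner `r ≥ d` of the lattice lemma (L1)**: for a smooth proper model
`𝒳/W(k)` of relative dimension `d ≤ r` and `m ≤ n ≤ n'`, the transition
`ℍ^{2r-1}(p^{r,m}_{r,n'}Ω•) → ℍ^{2r-1}(p^{r,m}_{r,n}Ω•)` of Hu's kernel sources is surjective
(`2r - 1 ≥ (r - 1) + d`). The weights `r ≤ d - 1` (Hodge–de Rham degeneration) are not treated
here. [folklore] -/
theorem huHReduce_surjective_of_dim_le [PerfectRing k p] {d : ℕ} (h𝒳 : IsSmoothProperModel d 𝒳) {r : ℕ}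
    (hr : d ≤ r) (m : ℕ) {n n' : ℕ} (hmn : m ≤ n) (h : n ≤ n') :
    Function.Surjective (KTheory.huHReduce p k 𝒳 r m h (2 * (r : ℤ) - 1)) :=
  huHReduce_surjective_of_le h𝒳 r m hmn h (by omega)

variable {𝒳} in
/-- **(L1) / (S) from its low-weight part.** For a smooth proper model `𝒳/W(k)` of relative dimension
`d`: if the odd transitions `ℍ^{2r-1}(p^{r,1}_{r,N+3}Ω•) → ℍ^{2r-1}(p^{r,1}_{r,N+2}Ω•)` are onto for the
LOW weights `1 ≤ r < d` (the part that needs the degeneration of Hodge–de Rham; not proved here),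
then they are onto for EVERY weight `r ≥ 1` — the weights `r ≥ d` being
`huHReduce_surjective_of_dim_le`. This is the shape in which the kernel-tower half of the `p`-adic
lifting argument consumes the statement (all `1 ≤ r < p`). [folklore] -/
theorem huHReduce_odd_surjective_of_lowWeights [PerfectRing k p] {d : ℕ}
    (h𝒳 : IsSmoothProperModel d 𝒳)
    (hlow : ∀ (N r : ℕ), 1 ≤ r → r < d →
      Function.Surjective (KTheory.huHReduce p k 𝒳 r 1 (Nat.le_succ (N + 2)) (2 * (r : ℤ) - 1)))
    (N r : ℕ) (hr : 1 ≤ r) :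
    Function.Surjective (KTheory.huHReduce p k 𝒳 r 1 (Nat.le_succ (N + 2)) (2 * (r : ℤ) - 1)) := by
  by_cases hrd : r < d
  · exact hlow N r hr hrd
  · exact huHReduce_surjective_of_dim_le h𝒳 (not_lt.mp hrd) 1 (by omega) (Nat.le_succ (N + 2))

end WittModel

end Literature.AlgebraicGeometry.Crystalline

end
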